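import Summits.ResolutionOfSingularities.ResolutionOfSingularities.Theorems.FrobeniusLadderFInjectiveMacaulayficationMonomialChartPresentationKernel
import Literature.AlgebraicGeometry.Resolution.BlowupPrincipalCharts
import Literature.AlgebraicGeometry.Resolution.BlowupsScaling
import Literature.AlgebraicGeometry.Resolution.AffineBlowupAlgebra
import HarnessLib

/-!
# BED Ω, GLOBAL PATCH (g-b), F4 (c) GLUE, THE TORIC CHARTS OF THE CLASS MODEL AS AFFINE OPENS: `Γ(Bl_{I_A} X, D₊(x^{m_c} t)) ≅ k[y]/(θ_c)` with the structure map
# `q ↦ θ_V q`, the cover by the vertex charts, and the chart formula for a second centre `(J)~·𝒪_{X̃}`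
# (crux `FInjectiveMacaulayfication` stmt-ResolutionOfSingularities-15315, chain w45a; res-L1-w45a-plan-1 BOOKED 2026-08-29T08:08:13Z «F4(c) remaining (g14): the identification GLUE»;
# seat res-L1-w45a-stub-3 g14)

[OURS · L1 W4.5a] Support file (`--supports stmt-ResolutionOfSingularities-15315 --as helper`); theorems only; GENERIC (the monomial-chart binder block of ✓ `MonomialChartPresentationKernel`:
hypersurface `X = Spec k[x]/(f)`, monomial centre `I_A`, unimodular chart matrix `V`, vertex `m`, neighbours `a i`, strict transform `θ_V f = y^d·g`); no named fact; NOT a statement of any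
manuscript; nothing of the crux is proved. AI-written (AI review is weaker than expert review).

WHAT. ✓ `exists_monomialChartPresentation` identifies the affine blow-up ALGEBRA `R[I_A/x^m]` with `k[y]/(g)`; the scheme-level glue (✓p709719 `PencilBlowupLocalCharts`) needs the same for
the SECTION RING of the affine open `D₊(x^m t) ⊆ Bl_{I_A} X` together with the structure map. This file supplies it:
* §1 ★★ `exists_sections_ringEquiv` — `Φ : Γ(Bl_{I_A} X, D₊(x^m t)) ≃+* k[y]/(g)` with `Φ (π^* q̄) = (θ_V q)‾` for every `q ∈ k[x]` (`affineBlowup.pull` = the structure map; Literature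
  ✓ `affineBlowup.appIso_hom_pull`, `reesChartEquiv_reesChartBase`, and ✓ `exists_monomialChartPresentation`);
* §2 ★ `ideal_comap_chartOpen_eq_comap` — for any ideal `J ⊆ k[x]`: the second centre `(J̄)~·𝒪_{X̃}` has, on `D₊(x^m t)`, the ideal `Φ⁻¹((θ_V J)·k[y]/(g))` (chart formula ✓ `ideal_comap_idealSheaf`);
* §3 ★ `exists_mem_chartOpen` — under the radical cover hypothesis `R[It]₊ ⊆ √(x^{m_c} t : c)` every point of `Bl_{I_A} X` lies in some vertex chart `D₊(x^{m_c} t)`.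
[folklore toric bookkeeping; cite: CoxLittleSchenck2011, §2.3; StacksProject, Tag 0804; GortzWedhorn2020, (13.19)]
-/

set_option linter.dupNamespace false

noncomputable section

open AlgebraicGeometry CategoryTheory Literature.AlgebraicGeometry.Resolution MvPolynomial

namespace Summit.ResolutionOfSingularities.ResolutionOfSingularities.Theorems.FInjectiveMacaulayfication.MonomialChartSections

open Summit.ResolutionOfSingularities.ResolutionOfSingularities.Theorems.FInjectiveMacaulayfication

variable {n : ℕ} {k : Type} [Field k]

/-! ## §1 The section ring of the vertex chart -/

/-- **`Γ(Bl_I(Spec R), D₊(bt)) ≅ R[I/b]`-transport**: for any ring isomorphism `e : R[I/b] ≅ B′` there is `Φ : Γ(Bl_I(Spec R), D₊(bt)) ≅ B′` with `Φ (π^* r) = e (r/1)` — the chain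
`Γ(Bl, D₊(bt)) ≅ Γ(Spec (R[It])_{(bt)}, ⊤) ≅ (R[It])_{(bt)} ≅ R[I/b]` (Literature ✓ `affineBlowup.appIso_hom_pull`, ✓ `reesChartEquiv_reesChartBase`). [cite: StacksProject, Tag 0804; GortzWedhorn2020, (13.19)] -/
theorem exists_sections_ringEquiv_of_ringEquiv {R : Type} [CommRing R] (I : Ideal R) (b : R) (hb : b ∈ I) {B' : Type} [CommRing B'] (e : blowupAlgebra I b ≃+* B') :
    ∃ Φ : Γ(affineBlowup I, affineBlowup.chartOpen (I := I) b hb) ≃+* B',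
      ∀ r : R, Φ (affineBlowup.pull I (affineBlowup.chartOpen (I := I) b hb) r) = e (algebraMap R (blowupAlgebra I b) r) := by
  let e₁ : Γ(affineBlowup I, affineBlowup.chartOpen (I := I) b hb) ≃+* Γ(Spec (.of (HomogeneousLocalization.Away (reesGrading I) (reesT b hb))), ⊤) :=
    ((affineBlowup.chartι (I := I) b hb).appIso ⊤).commRingCatIsoToRingEquiv
  let e₂ : Γ(Spec (.of (HomogeneousLocalization.Away (reesGrading I) (reesT b hb))), ⊤) ≃+* HomogeneousLocalization.Away (reesGrading I) (reesT b hb) :=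
    (Scheme.ΓSpecIso (.of (HomogeneousLocalization.Away (reesGrading I) (reesT b hb)))).commRingCatIsoToRingEquiv
  let e₃ : HomogeneousLocalization.Away (reesGrading I) (reesT b hb) ≃+* blowupAlgebra I b := reesChartEquiv (I := I) b hb
  refine ⟨e₁.trans (e₂.trans (e₃.trans e)), fun r => ?_⟩
  have h1 : e₁ (affineBlowup.pull I (affineBlowup.chartOpen (I := I) b hb) r) =
      (Scheme.ΓSpecIso (.of (HomogeneousLocalization.Away (reesGrading I) (reesT b hb)))).inv (reesChartBase b hb r) :=
    affineBlowup.appIso_hom_pull b hb r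
  have h2 : ∀ x, e₂ ((Scheme.ΓSpecIso (.of (HomogeneousLocalization.Away (reesGrading I) (reesT b hb)))).inv x) = x := fun x => by
    change ((Scheme.ΓSpecIso _).inv ≫ (Scheme.ΓSpecIso _).hom) x = x
    rw [Iso.inv_hom_id]; rfl
  rw [RingEquiv.trans_apply, RingEquiv.trans_apply, RingEquiv.trans_apply, h1, h2]
  exact congrArg e (reesChartEquiv_reesChartBase b hb r)

section Chart

variable (f : MvPolynomial (Fin n) k) (V : Matrix (Fin n) (Fin n) ℕ) (hV : IsUnit (V.map (Nat.cast : ℕ → ℤ)).det)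
  (m : Fin n →₀ ℕ) (a : Fin n → (Fin n →₀ ℕ))
  (hgen : ∀ i : Fin n, (Finsupp.equivFunOnFinite.symm (V.mulVec ⇑(a i)) : Fin n →₀ ℕ) =
    Finsupp.equivFunOnFinite.symm (V.mulVec ⇑m) + Finsupp.single i 1)
  (A : Finset (Fin n →₀ ℕ)) (haA : ∀ i, a i ∈ A)
  (hge : ∀ e ∈ A, (Finsupp.equivFunOnFinite.symm (V.mulVec ⇑m) : Fin n →₀ ℕ) ≤
    Finsupp.equivFunOnFinite.symm (V.mulVec ⇑e))
  (d : Fin n →₀ ℕ) (g : MvPolynomial (Fin n) k)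
  (hg : aeval (fun j : Fin n => ∏ i : Fin n, (X i : MvPolynomial (Fin n) k) ^ V i j) f = monomial d (1 : k) * g)
  (hunit : ∃ (N : ℕ) (r : Fin n →₀ ℕ), N • m = ∑ i : Fin n, d i • a i + r)
  (hcop : ∀ i : Fin n, ¬ (X i ∣ g))
  (hm : Ideal.Quotient.mk (Ideal.span {f}) (monomial m (1 : k)) ∈
    Ideal.span ((fun e : Fin n →₀ ℕ => Ideal.Quotient.mk (Ideal.span {f}) (monomial e (1 : k))) '' (A : Set (Fin n →₀ ℕ))))
include hV hgen haA hge hg hunit hcop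

/-- ★★ **THE SECTION RING OF THE VERTEX CHART IS `k[y]/(g)`**: there is a ring isomorphism `Φ : Γ(Bl_{I_A} X, D₊(x^m t)) ≅ k[y]/(g)` (`X = Spec k[x]/(f)`, `θ_V f = y^d·g`) under which the
pull-back `π^* q̄` of every `q ∈ k[x]` is the class of the chart substitution `θ_V q = q(∏ y_i^{V_{ij}})` (`exists_sections_ringEquiv_of_ringEquiv` with ✓ `exists_monomialChartPresentation`).
[OURS · F4 (c) glue; cite: StacksProject, Tag 0804; GortzWedhorn2020, (13.19); CoxLittleSchenck2011, §2.3] -/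
theorem exists_sections_ringEquiv :
    ∃ Φ : Γ(affineBlowup (Ideal.span ((fun e : Fin n →₀ ℕ => Ideal.Quotient.mk (Ideal.span {f}) (monomial e (1 : k))) '' (A : Set (Fin n →₀ ℕ)))),
        affineBlowup.chartOpen (Ideal.Quotient.mk (Ideal.span {f}) (monomial m (1 : k))) hm) ≃+* (MvPolynomial (Fin n) k ⧸ Ideal.span {g}),
      ∀ q : MvPolynomial (Fin n) k,
        Φ (affineBlowup.pull (Ideal.span ((fun e : Fin n →₀ ℕ => Ideal.Quotient.mk (Ideal.span {f}) (monomial e (1 : k))) '' (A : Set (Fin n →₀ ℕ))))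
            (affineBlowup.chartOpen (Ideal.Quotient.mk (Ideal.span {f}) (monomial m (1 : k))) hm) (Ideal.Quotient.mk (Ideal.span {f}) q)) =
          Ideal.Quotient.mk (Ideal.span {g}) (aeval (fun j : Fin n => ∏ i : Fin n, (X i : MvPolynomial (Fin n) k) ^ V i j) q) := by
  obtain ⟨eP, hbij, -, hθ⟩ := MonomialChartPresentationKernel.exists_monomialChartPresentation f V hV m a hgen A haA hge d g hg hunit hcop
  obtain ⟨Φ, hΦ⟩ := exists_sections_ringEquiv_of_ringEquiv _ _ hm (RingEquiv.ofBijective eP hbij).symm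
  refine ⟨Φ, fun q => ?_⟩
  have h4 : eP (Ideal.Quotient.mk (Ideal.span {g}) (aeval (fun j : Fin n => ∏ i : Fin n, (X i : MvPolynomial (Fin n) k) ^ V i j) q)) =
      algebraMap _ _ (Ideal.Quotient.mk (Ideal.span {f}) q) := by
    apply Subtype.ext
    rw [hθ q, Subalgebra.coe_algebraMap]
  rw [hΦ, ← h4]
  exact (RingEquiv.ofBijective eP hbij).symm_apply_apply _

/-! ## §2 The chart formula for a second centre -/

omit hV hgen haA hge hg hunit hcop in
/-- ★ **CHART FORMULA.** For every ideal `J ⊆ k[x]` the pulled-back ideal sheaf `(J̄)~·𝒪_{Bl}` (`J̄ = J·k[x]/(f)`) has, on the vertex chart `D₊(x^m t)`, the ideal `Φ⁻¹((θ_V J)‾)` — the image of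
`J` under the chart substitution, read in `k[y]/(g)`, pulled back along the isomorphism `Φ` of §1. [OURS · F4 (c) glue; cite: GortzWedhorn2020, (13.19)] -/
theorem ideal_comap_chartOpen_eq_comap
    (Φ : Γ(affineBlowup (Ideal.span ((fun e : Fin n →₀ ℕ => Ideal.Quotient.mk (Ideal.span {f}) (monomial e (1 : k))) '' (A : Set (Fin n →₀ ℕ)))),
        affineBlowup.chartOpen (Ideal.Quotient.mk (Ideal.span {f}) (monomial m (1 : k))) hm) ≃+* (MvPolynomial (Fin n) k ⧸ Ideal.span {g}))
    (hΦ : ∀ q : MvPolynomial (Fin n) k,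
        Φ (affineBlowup.pull (Ideal.span ((fun e : Fin n →₀ ℕ => Ideal.Quotient.mk (Ideal.span {f}) (monomial e (1 : k))) '' (A : Set (Fin n →₀ ℕ))))
            (affineBlowup.chartOpen (Ideal.Quotient.mk (Ideal.span {f}) (monomial m (1 : k))) hm) (Ideal.Quotient.mk (Ideal.span {f}) q)) =
          Ideal.Quotient.mk (Ideal.span {g}) (aeval (fun j : Fin n => ∏ i : Fin n, (X i : MvPolynomial (Fin n) k) ^ V i j) q))
    (J : Ideal (MvPolynomial (Fin n) k)) :
    ((affineBlowup.idealSheaf (J.map (Ideal.Quotient.mk (Ideal.span {f})))).comap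
        (affineBlowup.π (Ideal.span ((fun e : Fin n →₀ ℕ => Ideal.Quotient.mk (Ideal.span {f}) (monomial e (1 : k))) '' (A : Set (Fin n →₀ ℕ)))))).ideal
        (affineBlowup.chartOpen (Ideal.Quotient.mk (Ideal.span {f}) (monomial m (1 : k))) hm) =
      ((J.map (aeval (fun j : Fin n => ∏ i : Fin n, (X i : MvPolynomial (Fin n) k) ^ V i j)).toRingHom).map (Ideal.Quotient.mk (Ideal.span {g}))).comap Φ.toRingHom := by
  rw [ideal_comap_idealSheaf, Ideal.map_map]
  -- both sides are `J` pushed along ring maps that agree after `Φ`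
  have key : ((Ideal.Quotient.mk (Ideal.span {g})).comp (aeval (fun j : Fin n => ∏ i : Fin n, (X i : MvPolynomial (Fin n) k) ^ V i j)).toRingHom) =
      Φ.toRingHom.comp ((sectionsMap (affineBlowup.π _) (affineBlowup.chartOpen (Ideal.Quotient.mk (Ideal.span {f}) (monomial m (1 : k))) hm)).comp
        (Ideal.Quotient.mk (Ideal.span {f}))) := by
    refine MvPolynomial.ringHom_ext (fun c => ?_) (fun i => ?_)
    · exact (hΦ (MvPolynomial.C c)).symm
    · exact (hΦ (X i)).symm
  conv_rhs => rw [Ideal.map_map, key, ← Ideal.map_map, Ideal.comap_map_of_bijective Φ.toRingHom Φ.bijective]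

end Chart

/-! ## §3 The vertex charts cover -/

/-- ★ **THE VERTEX CHARTS COVER** `Bl_I(Spec R)` under the radical cover hypothesis `R[It]₊ ⊆ √(v₁t, …, v_tt)` (the output of ✓ `ReesCoverOfPowers.stub_reesCoverOfPowers`): every point lies
in some `D₊(vⱼt)`. [cite: StacksProject, Tag 0804] -/
-- adapted from `BlowupFiModelOfCover.exists_mem_basicOpen_of_irrelevant_le_radical` (same six lines) + Literature `affineBlowup.image_top_chartι`
theorem exists_mem_chartOpen {R : Type} [CommRing R] {I : Ideal R} {t : ℕ} (v : Fin t → R) (hv : ∀ j : Fin t, v j ∈ I)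
    (hcov : (HomogeneousIdeal.irrelevant (reesGrading I)).toIdeal ≤ (Ideal.span (Set.range fun j : Fin t => reesT (I := I) (v j) (hv j))).radical)
    (y : ↥(affineBlowup I)) : ∃ j : Fin t, y ∈ (affineBlowup.chartOpen (I := I) (v j) (hv j) : (affineBlowup I).Opens) := by
  have key : ∃ j : Fin t, y ∈ Proj.basicOpen (reesGrading I) (reesT (v j) (hv j)) := by
    by_contra! H
    simp only [Proj.mem_basicOpen, not_not] at H
    refine y.not_irrelevant_le (hcov.trans ?_)
    refine (Ideal.IsPrime.radical_le_iff y.isPrime).mpr ?_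
    rw [Ideal.span_le, Set.range_subset_iff]
    exact H
  obtain ⟨j, hj⟩ := key
  refine ⟨j, ?_⟩
  change y ∈ (affineBlowup.chartι (I := I) (v j) (hv j)) ''ᵁ ⊤
  rw [affineBlowup.image_top_chartι]
  exact hj

end Summit.ResolutionOfSingularities.ResolutionOfSingularities.Theorems.FInjectiveMacaulayfication.MonomialChartSections

end
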